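import Mathlib
import HarnessLib
import Literature.Analysis.FluidPDE.VorticityCalculus
import Summits.NavierStokesRegularity.NavierStokesRegularity.Theses.PoloidalWindowDoor
import Summits.NavierStokesRegularity.NavierStokesRegularity.Theses.LoopPeriodRatchet
import Summits.NavierStokesRegularity.NavierStokesRegularity.Theorems.PoloidalWindowDoorPoloidalWindowRigidityWindow
import Summits.NavierStokesRegularity.NavierStokesRegularity.Theorems.SymmetryModuliCountSymmetricLiouville
import Summits.NavierStokesRegularity.NavierStokesRegularity.Theorems.FrequencyGrowthExponent.Negative.Rigidity
import Summits.NavierStokesRegularity.NavierStokesRegularity.Theorems.ClockStretchingLawClockCeilingGermRigidity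
import Summits.NavierStokesRegularity.NavierStokesRegularity.Theorems.SymmetryModuliCountSymmetricLiouvilleSmallAtMinusInfinity
import Summits.NavierStokesRegularity.NavierStokesRegularity.Theorems.PoloidalWindowDoorPoloidalWindowRigidityStrata
import Summits.NavierStokesRegularity.NavierStokesRegularity.Theorems.PoloidalWindowDoorPoloidalWindowRigidityEternalCoreParaboloidGap
import Summits.NavierStokesRegularity.NavierStokesRegularity.Theorems.PoloidalWindowDoorPoloidalWindowRigidityEternalCoreScalingRecurrentCore


/-!
# LINE 23 `eternal_core` (v1.2) — ideator ns-idea-8 (generation 11, lens «barrier»), crux ⟨stmt-NavierStokesRegularity-19708⟩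
`PoloidalWindowRigidity` (+ item ⟨20428⟩ `LrcModEntire`), LADDER-NS N0, rung N0-LocalTubeDoorPoloidal, THICK column.

**No summit is proved by this line; 19708 / 20428 / ⟨27893⟩ / 22881 stay OPEN; NS regularity is NOT proved.**  What is PROVED here
(sorry-free, from the ONE analytic hand stub U2b) is a new structural theorem about EVERY pinned profile — **the core never cools**: a pinned
profile is NOT scale-covariantly small in backward paraboloids as `t → −∞` (`noCoolingPast`), quantitatively in EVERY backward scale window
(`eternalCore_of_pinned`); the blow-down hull at the pin therefore omits `0`, and Birkhoff recurrence in it (hand stub U2d, dynamics only) hands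
every research cell of the column a NONZERO, POLOIDAL, SCALING-RECURRENT blow-down profile `W` as data.  The kernel concludes LINE 22's research
cell `CellDefectiveReturnLeaf` (VERBATIM) from U2b, U2d and ONE refined research cell `CellDefectiveReturnLeafCore`.

## v1.2 (maintenance, 2026-08-29 — NO statement changed; defs blockdiff-identical to v1.1 0307d3096a2d / v1.0 2a19051e6b6d)
* U2d `stub_scalingRecurrentCore` PROVED BY NAME: ns-poloidal-K2-p2 g14's `…Theorems.PoloidalWindowDoorPoloidalWindowRigidityEternalCoreScalingRecurrentCore.scalingRecurrentCore`
  (p710334, statement VERBATIM = `ScalingRecurrentCore`; built on T1 p709077 `…EternalCoreScalingCore` + T2 p709473 `…EternalCoreScalingRecurrence.exists_scaling_recurrent`,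
  std axioms) ⇒ the column-wide export `scalingRecurrentBlowDown_of_pinned` (every pinned profile has a NON-ZERO, POLOIDAL, SCALING-RECURRENT blow-down)
  is now an UNCONDITIONAL theorem of the tree; sorries 2 → 1 (`stub_cellDefectiveReturnLeafCore`, research). No hand stub of LINE 23 remains.

## v1.1 (maintenance, 2026-08-29 ≈08:10Z — NO statement changed; defs blockdiff-identical to v1.0 2a19051e6b6d)
* U2b `stub_paraboloidGap` PROVED BY NAME: ns-es-p1 g8's `…Theorems.PoloidalWindowDoorPoloidalWindowRigidityEternalCoreParaboloidGap.paraboloidGap`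
  (+ `…ParaboloidGapTools`, `…ParaboloidGapStep`; statement VERBATIM, std axioms) ⇒ U2 `noCoolingPast`, `eternalCore_of_pinned` and the corners are
  now UNCONDITIONAL theorems of the tree modulo nothing; sorries 3 → 2 (`stub_scalingRecurrentCore` U2d hand, `stub_cellDefectiveReturnLeafCore` research); v1.2: 2 → 1 (U2d BY NAME).
* E1 (idea-crit-7 g7): `push_neg` → `push Not` (l. ≈250).
* K1 (idea-crit-7 g8 RE-GRADE 07:51:40Z, PASS STANDS, B+ U2b / B normal form): PRIOR ART = the tree's H1 programme on route PoloidalWindowDoor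
  (p469616 `…SymmetryModuliCountSymmetricLiouville.stub_smallAtMinusInfinityLiouville` + `exists_eps_small_vanishes`, p470468/p471914 `…PoloidalExtremal`
  (`classCompactness`, `exists_poloidal_extremal`), p473325 `…PoloidalExtremalRecurrent.exists_selfBlowDown_poloidal` — a NONZERO poloidal SELF-BLOW-DOWN
  profile in the FROZEN-POLOIDAL class by secondary extremalisation + Type-I compactness).  DELTA (three lines): CLASS — H1 works on the frozen-poloidal
  class at the critical constant, this line on EVERY pinned profile at its own constant; ANCHORING + MECHANISM — H1 anchors non-triviality by
  extremality of `C`, this line by the PIN through the LOCALISED gap U2b (`eternalCore_of_pinned`: quantitative non-smallness in every backward scale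
  window, which H1 does not state); GROUP — H1's self-blow-down is one fixed `λ`, U2d asks Birkhoff recurrence in the full blow-down hull.  U2d RE-SIZED
  L → M (critic): its Birkhoff half is the tree pattern `exists_selfBlowDown_poloidal` with `xs := 0`.  Grade of record: B+ (U2b), B (U2/U2d normal form).

## Why this line (lens «barrier»: the statement just outside the killed SMALL-PAST class, and B-g8-3 inverted)

The tree kills a Type-I ancient mild profile that is GLOBALLY small in the far past
(`SymmetryModuliCountSymmetricLiouville.stub_smallAtMinusInfinityLiouville`: `∀ε ∃T ∀t<T ∀x, √(−t)‖U‖ ≤ ε ⇒ U ≡ 0`, Kato/Koch–Tataru gap from `−∞`),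
and the census of this column records «blow-down AT THE PIN loses the window» (B-g8-3: the zoom-out `λU(λ²t, λx)`, `λ → ∞`, forgets the thick
window and the pins, so CKN/ESS/backward-uniqueness levers have nothing to hold).  The statement JUST OUTSIDE the small-past class is LOCAL
smallness in backward PARABOLOIDS — `LocallySmallPast U := ∀ε ∀R ∃T ∀t ≤ T ∀‖x‖ ≤ R√(−t), √(−t)‖U(t,x)‖ ≤ ε` — which is exactly «every
blow-down limit at the pin is `0`».  **U2 (PROVED here from U2b): no pinned profile has a locally small past.**  The lever is the
**PARABOLOID GAP U2b** (hand, L; template `SymmetricLiouville.Negative.exists_eps_small_vanishes` + two tail estimates): scale-covariant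
`ε`-smallness (`ε ≤ ε₁(C)`) on ONE parabolic window `{r ∈ [4t₀,t₀], ‖y‖ ≤ R√(−r)}`, `R ≥ R₁(C,ε)`, propagates FORWARD along the shrinking
paraboloid `{s ∈ [t₀,0), ‖x‖ ≤ (R/4)√(−s)}` with bound `2ε` — Oseen identity from `4s` to `s`: the heat part halves the scale-covariant size
(`√(−s)/√(−4s) = ½`) up to a Gaussian tail `≤ C·e^{−R²/192}` from the uncontrolled far field, the Duhamel part costs `≤ K M (2ε)²` on the
controlled near field, `≤ 16π ln4·C_O C²/(ηR)` from the far field (the Oseen kernel's `|z|^{-4}` tail against the a-priori bound `C/√(−r)`),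
and `≤ 2K C² √(2η+η²)` on the most recent stretch `[(1+η)²s, s]` (a-priori bound), all four SCALE-INVARIANT, so the geometric time steps of
LINE 22's U1b run to `0⁻`.  The TIP of the paraboloid is the pin: `|N| = |U₂(−1,0)| ≤ 2ε` — absurd for `ε < |N|/2`.  So B-g8-3 is inverted:
the blow-down at the pin does lose the window, but it CANNOT VANISH — `0 ∉ α(U)` quantitatively (`EternalCore ε₀ R₀`: every backward scale
window `[4t₀,t₀]`, `t₀ < −1`, carries a point `‖y‖ ≤ R₀√(−r)` with `√(−r)‖U(r,y)‖ ≥ ε₀`), and what SURVIVES the blow-down is typed: the class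
`A_C` (`isTypeIAncientMild_zoom`), e₂-poloidality (`PoloidalExtremal.poloidal_of_tendsto`), the extremal bound `√(−s)|W₂| ≤ |N|`, the eternal
core (closed condition), and — because `0 ∉ α(U)` makes Zorn + Birkhoff honest (the g11 dead end «minimal sets collapse to {0}» is removed by
U2) — SCALING RECURRENCE: `W = lim λₙU(λₙ²·, λₙ·)` with `μₙW(μₙ²·, μₙ·) → W`, `μₙ → ∞` (U2d, hand, L; template = hot_hull H6 `LeafRecurrence`
for the translation group).  The exactly scaling-symmetric classes next door are dead or named: backward SELF-SIMILAR pinned profiles are absurd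
BY NAME (`PoloidalWindowDoorPoloidalWindowRigidityStrata.eq_zero_of_selfSimilar`, Tsai), globally small pasts BY NAME (above); a DISCRETELY
self-similar `W` (`Literature.Analysis.FluidPDE.IsDiscretelySelfSimilar`) is the KNSS-(L) wall (pub-ns-dss census; OPEN) — said so: the
residue inherits that wall and does not claim to breach it.

## Why novel vs the listed lines
First FAR-PAST statement on the column (hot_split / leaf_uniform / hot_forest / hot_hull / uniform_return all live at time `−1` or on bounded
time windows); first localised (paraboloid) gap lemma in the tree (`rg -l -i "paraboloid|locallySmall|blowdown" Theorems/` → blow-down files of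
OTHER routes (ThreadingFlux, ScenarioCensus screw blow-down, HalfSpace Gauss blow-down) use exact symmetry or decay, none a windowed local gap;
`SmallAtMinusInfinity` is the global class next door).  Not hot_hull again (scaling group at the pin, not translations at hot points; no
re-pinning — the pin is SPENT at the tip of the paraboloid), not uniform_return again (no approximate symmetry hypothesis: U2 is unconditional
for pinned profiles), not `minimal_hull`/secondary extremalisation (B-g10-2: no extremal element is chosen; Birkhoff recurrence is applied to the
blow-down hull exactly as H6 applies it to the translation hull, and only AFTER `0` has been excluded from it by a theorem).

## Deliverables
* U2b `ParaboloidGap` (v1.1: PROVED BY NAME, es-p1 g8) + `stub_paraboloidGap`; U2d `ScalingRecurrentCore` (v1.2: PROVED BY NAME, K2-p2 g14 p710334; M after the critic's re-size) + `stub_scalingRecurrentCore`.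
* PROVED (no sorry): `notSmallWindow_of_pinned`, U2 `noCoolingPast`, `eternalCore_of_pinned`, corner S `selfSimilar_absurd` (BY NAME Strata),
  corner GS `smallPast_absurd` (BY NAME SmallAtMinusInfinity), export `pinned_scalingRecurrentCore`, kernel `cellDefectiveReturnLeaf_of_core`.
* Research cell `CellDefectiveReturnLeafCore` (OPEN): LINE 22's DEFECTIVE-RETURN-LEAF (VERBATIM) + the far-past data `(λs, W, μs, ε₀, R₀)`.
* bears_on: rung N0 THICK column — U2 holds for EVERY pinned profile (thick or thin), so every cell of hot_split/leaf_uniform/hot_forest/hot_hull/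
  uniform_return and S0 may import `EternalCore` + the recurrent blow-down for free (`pinned_scalingRecurrentCore`).
* Cheapest falsifier: U2b dies iff one of the four scale-invariant constants is not uniform — each is a closed-form integral (Gaussian tail,
  `∫₁⁴(u−1)^{-1/2}u^{-1}du`, `∫_{|z|≥d}|z|^{-4}dz = 4π/d`, `∫(s−r)^{-1/2}dr`); U2 cannot die given U2b (15 checked lines); U2d dies iff the F3 topology
  on `α(U)` is not compact metrisable (it is: countably many seminorms, class equicontinuity); the CUT is free (data added).  Instrument row:
  Kato/Koch–Tataru localised gap + Type-I compactness + Birkhoff; no maximum principle, no frequency functional, no finite jet, no averaging.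
* Honest label: «one new provable localisation lemma + a proved unconditional exclusion (no cooling past) + a Birkhoff blow-down scaffold whose
  residue inherits the DSS wall».
-/

open scoped InnerProductSpace RealInnerProductSpace Laplacian

set_option linter.dupNamespace false
set_option linter.unusedVariables false

namespace Summit.NavierStokesRegularity.NavierStokesRegularity.Cruxes.PoloidalWindowRigidity.EternalCore

open Set Function MeasureTheory Filter
open Literature.Analysis Literature.Analysis.FluidPDE
open Summit.NavierStokesRegularity.NavierStokesRegularity.Theses.PoloidalWindowDoor
open Summit.NavierStokesRegularity.NavierStokesRegularity.Theorems

/-! ## §1 The column's objects (VERBATIM hot_split / hot_hull / uniform_return) -/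


/-- **Pinned** — VERBATIM hot_split: Type-I decay, continuity, mild identity, div-free, e₃-poloidal, `N := v₂(−1,0) ≠ 0`, the global bound
`√(−t)|v₂| ≤ |N|`, `∇v₂(−1,0) = 0`, the time and Laplace pins. -/
def Pinned (C : ℝ) (v : ℝ → EuclideanSpace ℝ (Fin 3) → EuclideanSpace ℝ (Fin 3)) : Prop :=
  Literature.Analysis.FluidPDE.HasTypeITimeDecay C v ∧
  ContinuousOn (Function.uncurry v) (Set.Iio (0 : ℝ) ×ˢ Set.univ) ∧
  (∀ s t : ℝ, s < t → t < 0 → ∀ x, v t x =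
    Literature.Analysis.UnboundedOperators.heatExtension (v s) (t - s) x -
      Literature.Analysis.FluidPDE.oseenDuhamel 1 s v v t x) ∧
  (∀ t < 0, Literature.Analysis.FluidPDE.VectorCalculus.IsDivFree (v t)) ∧
  (∀ s < 0, ∀ y, ⟪Literature.Analysis.FluidPDE.curl (v s) y, EuclideanSpace.single 2 1⟫_ℝ = 0) ∧
  v (-1) 0 2 ≠ 0 ∧ (∀ t < 0, ∀ x, Real.sqrt (-t) * |v t x 2| ≤ |v (-1) 0 2|) ∧
  (∀ h : EuclideanSpace ℝ (Fin 3), fderiv ℝ (v (-1)) 0 h 2 = 0) ∧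
  (deriv (fun s => v s 0 2) (-1) = v (-1) 0 2 / 2 ∧ v (-1) 0 2 * (Δ (fun y => v (-1) y 2)) 0 ≤ 0)

/-- **ThickWindow** — VERBATIM hot_split. -/
def ThickWindow (v : ℝ → EuclideanSpace ℝ (Fin 3) → EuclideanSpace ℝ (Fin 3)) (W : Set (ℝ × EuclideanSpace ℝ (Fin 3))) : Prop :=
  IsOpen W ∧ W ⊆ Set.Iio (0 : ℝ) ×ˢ Set.univ ∧
  (∀ z ∈ W, (Literature.Analysis.FluidPDE.curl (v z.1) z.2 ≠ 0 ∧
      (fderiv ℝ (v z.1) z.2 (EuclideanSpace.single 0 1) 2 ≠ 0 ∨ fderiv ℝ (v z.1) z.2 (EuclideanSpace.single 1 1) 2 ≠ 0) ∧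
      (fderiv ℝ (v z.1) z.2 (EuclideanSpace.single 2 1) 0 ≠ 0 ∨ fderiv ℝ (v z.1) z.2 (EuclideanSpace.single 2 1) 1 ≠ 0)) ∧
    (fderiv ℝ (fun x => fderiv ℝ (v z.1) x (EuclideanSpace.single 2 1) 2) z.2 (EuclideanSpace.single 0 1) *
          fderiv ℝ (v z.1) z.2 (EuclideanSpace.single 1 1) 2 -
        fderiv ℝ (fun x => fderiv ℝ (v z.1) x (EuclideanSpace.single 2 1) 2) z.2 (EuclideanSpace.single 1 1) *
          fderiv ℝ (v z.1) z.2 (EuclideanSpace.single 0 1) 2 ≠ 0)) ∧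
  (∀ m : ℝ → ℝ → ℝ, ∀ W₁ : Set (ℝ × EuclideanSpace ℝ (Fin 3)), W₁ ⊆ W → IsOpen W₁ → W₁.Nonempty →
      ∃ z ∈ W₁, ∃ b : Fin 3, b ≠ 2 ∧
        fderiv ℝ (v z.1) z.2 (EuclideanSpace.single 2 1) b ≠
          m z.1 (z.2 2) * fderiv ℝ (v z.1) z.2 (EuclideanSpace.single b 1) 2) ∧
  (∀ r : ℝ, 0 < r → (Metric.ball ((-1 : ℝ), (0 : EuclideanSpace ℝ (Fin 3))) r ∩ W).Nonempty)

/-- **Peakless** — VERBATIM hot_split: no island bracket of `σ·v₂(s,·)` on any horizontal plane at any time `s < 0`. -/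
def Peakless (v : ℝ → EuclideanSpace ℝ (Fin 3) → EuclideanSpace ℝ (Fin 3)) : Prop :=
  ∀ (s z₀ σ M : ℝ) (K O : Set (EuclideanSpace ℝ (Fin 3))), s < 0 →
    ((σ = 1 ∨ σ = -1) ∧ IsCompact K ∧ K.Nonempty ∧ (∀ y ∈ K, y 2 = z₀ ∧ σ * v s y 2 = M) ∧
      IsOpen O ∧ K ⊆ O ∧ (∀ y ∈ O, y 2 = z₀ → σ * v s y 2 ≤ M) ∧
      (∀ y ∈ O, y 2 = z₀ → σ * v s y 2 = M → y ∈ K)) → False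

/-- The HOT SET of the hot-spot plane `P₀ = {y₂ = 0}` at time `−1` — VERBATIM hot_split: `H := {y : y₂ = 0, v₂(−1,y) = v₂(−1,0)}`. -/
def hotSet (v : ℝ → EuclideanSpace ℝ (Fin 3) → EuclideanSpace ℝ (Fin 3)) : Set (EuclideanSpace ℝ (Fin 3)) :=
  {y | y 2 = 0 ∧ v (-1) y 2 = v (-1) 0 2}


/-! ## The leaf-uniform quantities (second derivatives of `w := v₂(−1,·)` in the column's nested-`fderiv` convention) -/

/-- `∂_b∂_a v₂(−1,·)(y)` — the second derivative of the vertical component of the time-`−1` slice, nested `fderiv` convention of the column. -/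
noncomputable def hess (v : ℝ → EuclideanSpace ℝ (Fin 3) → EuclideanSpace ℝ (Fin 3)) (y a b : EuclideanSpace ℝ (Fin 3)) : ℝ :=
  fderiv ℝ (fun x => fderiv ℝ (fun x' => v (-1) x' 2) x a) y b

/-- `Δₕv₂(−1,·)(y) = ∂₀₀v₂ + ∂₁₁v₂` — the HORIZONTAL Laplacian of the vertical component at time `−1`. -/
noncomputable def lapH (v : ℝ → EuclideanSpace ℝ (Fin 3) → EuclideanSpace ℝ (Fin 3)) (y : EuclideanSpace ℝ (Fin 3)) : ℝ :=
  hess v y (EuclideanSpace.single 0 1) (EuclideanSpace.single 0 1) + hess v y (EuclideanSpace.single 1 1) (EuclideanSpace.single 1 1)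


/-! ## §2 The far past of a pinned profile: locally small pasts, eternal cores, the paraboloid gap -/

/-- **LocallySmallPast** — scale-covariant smallness in backward PARABOLOIDS as `t → −∞`: for every `ε > 0` and aperture `R` there is a time `T`
before which `√(−t)‖U(t,x)‖ ≤ ε` whenever `‖x‖ ≤ R√(−t)`.  Equivalently: every blow-down limit `lim λₙU(λₙ²·, λₙ·)` (`λₙ → ∞`) at the pin is `0`.
The GLOBAL version (all `x`) is the dead class next door (`stub_smallAtMinusInfinityLiouville`). -/
def LocallySmallPast (U : ℝ → EuclideanSpace ℝ (Fin 3) → EuclideanSpace ℝ (Fin 3)) : Prop :=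
  ∀ ε : ℝ, 0 < ε → ∀ R : ℝ, ∃ T : ℝ, T < 0 ∧
    ∀ t : ℝ, t ≤ T → ∀ x : EuclideanSpace ℝ (Fin 3), ‖x‖ ≤ R * Real.sqrt (-t) → Real.sqrt (-t) * ‖U t x‖ ≤ ε

/-- **EternalCore ε₀ R₀ T₀ U** — every backward scale window `[4t₀, t₀]`, `t₀ < T₀`, carries a point of the paraboloid `‖y‖ ≤ R₀√(−r)` where the
scale-covariant speed is at least `ε₀`.  SCALE-INVARIANT for `T₀ = 0`; a closed condition under locally uniform limits. -/
def EternalCore (ε₀ R₀ T₀ : ℝ) (U : ℝ → EuclideanSpace ℝ (Fin 3) → EuclideanSpace ℝ (Fin 3)) : Prop :=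
  ∀ t₀ : ℝ, t₀ < T₀ → ∃ r ∈ Set.Icc (4 * t₀) t₀, ∃ y : EuclideanSpace ℝ (Fin 3),
    ‖y‖ ≤ R₀ * Real.sqrt (-r) ∧ ε₀ ≤ Real.sqrt (-r) * ‖U r y‖

/-- **U2b `ParaboloidGap` (PROVABLE, L — hand target; template `SymmetricLiouville.Negative.exists_eps_small_vanishes` (Chae–Wolf 2017 Step 1 /
Koch–Tataru (14)), run in the geometric time steps of LINE 22's U1b, plus two tail estimates).**  For every Type-I constant `C` there is `ε₁ > 0`,
and for every `ε ≤ ε₁` an aperture `R₁ = R₁(C, ε)`, such that for a class profile `U`, scale-covariant `ε`-smallness on ONE parabolic window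
`{r ∈ [4t₀, t₀], ‖y‖ ≤ R√(−r)}` (`R ≥ R₁`) propagates FORWARD to `2ε`-smallness on the whole shrinking paraboloid `{s ∈ [t₀, 0), ‖x‖ ≤ (R/4)√(−s)}`.
Proof: Oseen identity from `4s` to `s` (`IsTypeIAncientMild.mild_eq`) at `‖x‖ ≤ (R/4)√(−s)`: heat part `≤ ½·(bound at 4s) + C·(Gaussian tail beyond
distance (R/4)√(−s) at variance 6(−s)) ≤ ½β(4s) + cC e^{−R²/192}`; Duhamel near field (`r ≤ (1+η)²s`, `‖y−x‖ ≤ η(R/4)√(−s)`, inside the controlled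
paraboloid) `≤ K M (2ε)²` (`exists_norm_oseenKernel_le`, `M = ∫₁⁴ (u−1)^{-1/2} u^{-1} du`); Duhamel far field `≤ C_O C² ln 4 · 4π/(η(R/4)√(−s))`, i.e.
`≤ 16π ln4 C_O C²/(ηR)` after the factor `√(−s)` (kernel tail `|z|^{-4}`, a-priori bound `C/√(−r)`); most recent stretch `[(1+η)²s, s]` with the
a-priori bound `≤ 2KC²√(2η+η²)` (`ChaeWolf.norm_integral_oseenKernel_le`).  All four constants are SCALE-INVARIANT; choose `η = η(C,ε)`, then
`R₁`, then `ε₁ ≤ 1/(32KM)`; the recursion `β ≤ ½β_prev + ¾ε` keeps `β ≤ 2ε` along the steps `sⱼ₊₁ = (1−η″)sⱼ → 0⁻` (`(1+η)²(1−η″) ≥ 1`).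
Why it might fail: only through a non-uniform constant — each is a closed-form integral. -/
def ParaboloidGap : Prop :=
  ∀ C : ℝ, ∃ ε₁ : ℝ, 0 < ε₁ ∧ ∀ ε : ℝ, 0 < ε → ε ≤ ε₁ → ∃ R₁ : ℝ, 0 < R₁ ∧ ∀ R : ℝ, R₁ ≤ R →
    ∀ (U : ℝ → EuclideanSpace ℝ (Fin 3) → EuclideanSpace ℝ (Fin 3)), IsTypeIAncientMild C U → ∀ t₀ : ℝ, t₀ < 0 →
      (∀ r ∈ Set.Icc (4 * t₀) t₀, ∀ y : EuclideanSpace ℝ (Fin 3), ‖y‖ ≤ R * Real.sqrt (-r) → Real.sqrt (-r) * ‖U r y‖ ≤ ε) →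
      ∀ s : ℝ, t₀ ≤ s → s < 0 → ∀ x : EuclideanSpace ℝ (Fin 3), ‖x‖ ≤ R / 4 * Real.sqrt (-s) →
        Real.sqrt (-s) * ‖U s x‖ ≤ 2 * ε

/-- **stub U2b** — v1.1: PROVED BY NAME, ns-es-p1 g8's landed
`…Theorems.PoloidalWindowDoorPoloidalWindowRigidityEternalCoreParaboloidGap.paraboloidGap` (statement VERBATIM = `ParaboloidGap` unfolded; std axioms). -/
theorem stub_paraboloidGap : ParaboloidGap :=
  Summit.NavierStokesRegularity.NavierStokesRegularity.Theorems.PoloidalWindowDoorPoloidalWindowRigidityEternalCoreParaboloidGap.paraboloidGap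

/-! ## §3 PROVED: the core of a pinned profile never cools (U2), quantitatively in every scale window -/

/-- The class of a pinned profile (tree `isTypeIAncientMild_of_class`). -/
theorem class_of_pinned {C : ℝ} {U : ℝ → EuclideanSpace ℝ (Fin 3) → EuclideanSpace ℝ (Fin 3)} (hP : Pinned C U) : IsTypeIAncientMild C U :=
  PoloidalWindowDoorPoloidalWindowRigidityWindow.isTypeIAncientMild_of_class hP.1 hP.2.1 hP.2.2.1 hP.2.2.2.1

/-- A pinned profile is not identically zero (`N = U₂(−1,0) ≠ 0`). -/
theorem pinned_absurd_of_zero {C : ℝ} {U : ℝ → EuclideanSpace ℝ (Fin 3) → EuclideanSpace ℝ (Fin 3)} (hP : Pinned C U)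
    (hz : ∀ t < 0, ∀ x, U t x = 0) : False := by
  have hN : U (-1) 0 2 ≠ 0 := hP.2.2.2.2.2.1
  have h0 : U (-1) 0 = 0 := hz (-1) (by norm_num) 0
  exact hN (by rw [h0]; rfl)

/-- `|N| ≤ ‖U(−1,0)‖` (a coordinate is bounded by the Euclidean norm). -/
theorem absN_le_norm (U : ℝ → EuclideanSpace ℝ (Fin 3) → EuclideanSpace ℝ (Fin 3)) : |U (-1) 0 2| ≤ ‖U (-1) 0‖ := by
  have h := EuclideanSpace.norm_eq (U (-1) 0)
  have h2 : |U (-1) 0 2| ^ 2 ≤ ∑ i, |U (-1) 0 i| ^ 2 :=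
    Finset.single_le_sum (f := fun i => |U (-1) 0 i| ^ 2) (fun i _ => by positivity) (Finset.mem_univ (2 : Fin 3))
  have h3 : |U (-1) 0 2| ^ 2 = U (-1) 0 2 ^ 2 := sq_abs _
  rw [h]
  have h4 : Real.sqrt (|U (-1) 0 2| ^ 2) = |U (-1) 0 2| := Real.sqrt_sq (abs_nonneg _)
  calc |U (-1) 0 2| = Real.sqrt (|U (-1) 0 2| ^ 2) := h4.symm
    _ ≤ Real.sqrt (∑ i, |U (-1) 0 i| ^ 2) := Real.sqrt_le_sqrt h2
    _ = Real.sqrt (∑ i, ‖U (-1) 0 i‖ ^ 2) := by simp [Real.norm_eq_abs]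

/-- **The pin refuses a small parabolic window (PROVED from U2b).**  For a pinned profile there are `ε₀ > 0`, `R₀ > 0` such that NO backward scale
window `[4t₀,t₀]` with `t₀ ≤ −1` is `ε₀`-small on the paraboloid `‖y‖ ≤ R₀√(−r)`: the forward paraboloid from such a window has the pin `(−1,0)` in
it, where `√1·‖U(−1,0)‖ ≥ |N| > 2ε₀`. -/
theorem notSmallWindow_of_pinned (hG : ParaboloidGap) {C : ℝ} {U : ℝ → EuclideanSpace ℝ (Fin 3) → EuclideanSpace ℝ (Fin 3)} (hP : Pinned C U) :
    ∃ ε₀ : ℝ, 0 < ε₀ ∧ ∃ R₀ : ℝ, 0 < R₀ ∧ ∀ t₀ : ℝ, t₀ ≤ -1 →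
      ¬ (∀ r ∈ Set.Icc (4 * t₀) t₀, ∀ y : EuclideanSpace ℝ (Fin 3), ‖y‖ ≤ R₀ * Real.sqrt (-r) → Real.sqrt (-r) * ‖U r y‖ ≤ ε₀) := by
  obtain ⟨ε₁, hε₁, hg⟩ := hG C
  have hN : U (-1) 0 2 ≠ 0 := hP.2.2.2.2.2.1
  have ha : 0 < |U (-1) 0 2| := abs_pos.2 hN
  set ε : ℝ := min ε₁ (|U (-1) 0 2| / 4) with hεdef
  have hε : 0 < ε := lt_min hε₁ (by positivity)
  have hεle : ε ≤ ε₁ := min_le_left _ _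
  have hεa : ε ≤ |U (-1) 0 2| / 4 := min_le_right _ _
  obtain ⟨R₁, hR₁, hR⟩ := hg ε hε hεle
  refine ⟨ε, hε, R₁, hR₁, fun t₀ ht₀ hsmall => ?_⟩
  have ht₀' : t₀ < 0 := by linarith
  have h := hR R₁ le_rfl U (class_of_pinned hP) t₀ ht₀' hsmall (-1) ht₀ (by norm_num) 0
    (by rw [norm_zero]; positivity)
  have h1 : Real.sqrt (-(-1 : ℝ)) = 1 := by norm_num
  rw [h1, one_mul] at h
  have h2 := absN_le_norm U
  linarith

/-- **U2 `noCoolingPast` — NO PINNED PROFILE HAS A LOCALLY SMALL PAST (PROVED from U2b).**  Every blow-down of a pinned profile at its pin is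
NON-TRIVIAL: the statement just outside the dead global class `stub_smallAtMinusInfinityLiouville`, decided for the whole pinned class. -/
theorem noCoolingPast (hG : ParaboloidGap) {C : ℝ} {U : ℝ → EuclideanSpace ℝ (Fin 3) → EuclideanSpace ℝ (Fin 3)} (hP : Pinned C U) :
    ¬ LocallySmallPast U := by
  intro hL
  obtain ⟨ε₀, hε₀, R₀, hR₀, hwin⟩ := notSmallWindow_of_pinned hG hP
  obtain ⟨T, hT, hsmall⟩ := hL ε₀ hε₀ R₀
  refine hwin (min T (-1)) (min_le_right _ _) fun r hr y hy => ?_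
  exact hsmall r (le_trans hr.2 (min_le_left _ _)) y hy

/-- **`eternalCore_of_pinned` — THE CORE NEVER COOLS, quantitatively (PROVED from U2b).**  A pinned profile has an ETERNAL CORE: `ε₀ > 0`, `R₀ > 0`
with a point `‖y‖ ≤ R₀√(−r)`, `√(−r)‖U(r,y)‖ ≥ ε₀` in EVERY backward scale window `[4t₀, t₀]`, `t₀ < −1`.  Hence `0 ∉ α(U)`: no blow-down sequence
at the pin tends to `0`. -/
theorem eternalCore_of_pinned (hG : ParaboloidGap) {C : ℝ} {U : ℝ → EuclideanSpace ℝ (Fin 3) → EuclideanSpace ℝ (Fin 3)} (hP : Pinned C U) :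
    ∃ ε₀ : ℝ, 0 < ε₀ ∧ ∃ R₀ : ℝ, 0 < R₀ ∧ EternalCore ε₀ R₀ (-1) U := by
  obtain ⟨ε₀, hε₀, R₀, hR₀, hwin⟩ := notSmallWindow_of_pinned hG hP
  refine ⟨ε₀, hε₀, R₀, hR₀, fun t₀ ht₀ => ?_⟩
  by_contra hcon
  push Not at hcon
  exact hwin t₀ ht₀.le fun r hr y hy => (hcon r hr y hy).le

/-! ## §4 Corners BY NAME: the exactly scale-symmetric and the globally small pasts -/

/-- **Corner S — a backward SELF-SIMILAR pinned profile is absurd (BY NAME `PoloidalWindowDoorPoloidalWindowRigidityStrata.eq_zero_of_selfSimilar`,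
Tsai 1998).**  The blow-down of a self-similar profile is the profile itself; the tree kills it outright. -/
theorem selfSimilar_absurd {C : ℝ} {U : ℝ → EuclideanSpace ℝ (Fin 3) → EuclideanSpace ℝ (Fin 3)} (hP : Pinned C U) {a : ℝ} (ha : 0 < a)
    {V : EuclideanSpace ℝ (Fin 3) → EuclideanSpace ℝ (Fin 3)} (hss : ∀ s < 0, ∀ y, U s y = lerayBackward a 0 V s y) : False :=
  pinned_absurd_of_zero hP
    (PoloidalWindowDoorPoloidalWindowRigidityStrata.eq_zero_of_selfSimilar ha hP.1 hP.2.1 hP.2.2.1 hP.2.2.2.1 hss)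

/-- **Corner GS — a GLOBALLY small past is absurd (BY NAME `SymmetryModuliCountSymmetricLiouville.stub_smallAtMinusInfinityLiouville`).**  The dead
class next door to `LocallySmallPast`: smallness for ALL `x` before some time. -/
theorem smallPast_absurd {C : ℝ} {U : ℝ → EuclideanSpace ℝ (Fin 3) → EuclideanSpace ℝ (Fin 3)} (hP : Pinned C U)
    (h : ∀ ε > 0, ∃ T < 0, ∀ t < T, ∀ x, Real.sqrt (-t) * ‖U t x‖ ≤ ε) : False :=
  pinned_absurd_of_zero hP (SymmetryModuliCountSymmetricLiouville.stub_smallAtMinusInfinityLiouville C U (class_of_pinned hP) h)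

/-- A globally small past is in particular a locally small past (so corner GS is also a special case of U2). -/
theorem locallySmallPast_of_smallPast {U : ℝ → EuclideanSpace ℝ (Fin 3) → EuclideanSpace ℝ (Fin 3)}
    (h : ∀ ε > 0, ∃ T < 0, ∀ t < T, ∀ x, Real.sqrt (-t) * ‖U t x‖ ≤ ε) : LocallySmallPast U := by
  intro ε hε R
  obtain ⟨T, hT, hs⟩ := h ε hε
  refine ⟨T - 1, by linarith, fun t ht x _ => hs t (by linarith) x⟩

/-! ## §5 The blow-down hull without `0`: scaling recurrence (U2d — LANDED, wired by name in v1.2) -/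

/-- **U2d `ScalingRecurrentCore` (PROVABLE, L — hand target; pure dynamics + Type-I compactness; template = hot_hull H6 `LeafRecurrence` for the
translation group, here for the scaling group `nsRescale λ` at the pin).**  A class profile `U` (Type-I constant `C`), e₂-poloidal, with the
extremal bound `√(−t)|U₂| ≤ M` and an ETERNAL CORE `(ε₀, R₀)` before time `−1`, has a blow-down limit `W = lim nsRescale (λₙ) U` (`λₙ ≥ n+1`,
slice-wise locally uniformly; F3 `SymmetryModuliCountSymmetricLiouville.classCompactness` + `isTypeIAncientMild_zoom`) which is again of class `C`,
e₂-poloidal (`PoloidalExtremal.poloidal_of_tendsto` with the class's uniform slice `C²` bounds `exists_norm_iteratedFDeriv_le_of_typeI`), obeys the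
same extremal bound, has the eternal core `(ε₀, R₀)` in EVERY window `t₀ < 0` (closed condition; `0 ∉ α(U)`), and is SCALING-RECURRENT:
`nsRescale (μₙ) W → W` slice-wise locally uniformly along some `μₙ ≥ n+1`.  Proof of the last clause: `α(U)` (all blow-down limits) is a non-empty,
closed, `nsRescale`-invariant subset of the compact metrisable space `(A_C, slice-wise local uniform convergence)` every element of which has the
eternal core; Zorn gives a minimal closed invariant subset `M ∌ 0`, and for `W ∈ M`, `α(W) ⊆ M` is closed invariant non-empty, so `α(W) = M ∋ W`.
Why it might fail: only if the F3 topology restricted to `A_C` were not compact metrisable with `λ ↦ nsRescale λ` continuous — it is (countably many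
seminorms; class equicontinuity in `t` from the mild identity). -/
def ScalingRecurrentCore : Prop :=
  ∀ (C M ε₀ R₀ : ℝ) (U : ℝ → EuclideanSpace ℝ (Fin 3) → EuclideanSpace ℝ (Fin 3)), IsTypeIAncientMild C U →
    (∀ s < 0, ∀ y, ⟪Literature.Analysis.FluidPDE.curl (U s) y, EuclideanSpace.single 2 1⟫_ℝ = 0) →
    (∀ t < 0, ∀ x, Real.sqrt (-t) * |U t x 2| ≤ M) →
    0 < ε₀ → EternalCore ε₀ R₀ (-1) U →
    ∃ (lam : ℕ → ℝ) (W : ℝ → EuclideanSpace ℝ (Fin 3) → EuclideanSpace ℝ (Fin 3)) (mu : ℕ → ℝ),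
      (∀ n : ℕ, (n : ℝ) + 1 ≤ lam n) ∧ IsTypeIAncientMild C W ∧
      (∀ t < 0, TendstoLocallyUniformly (fun n => nsRescale (lam n) U t) (W t) Filter.atTop) ∧
      (∀ s < 0, ∀ y, ⟪Literature.Analysis.FluidPDE.curl (W s) y, EuclideanSpace.single 2 1⟫_ℝ = 0) ∧
      (∀ t < 0, ∀ x, Real.sqrt (-t) * |W t x 2| ≤ M) ∧
      EternalCore ε₀ R₀ 0 W ∧
      (∀ n : ℕ, (n : ℝ) + 1 ≤ mu n) ∧
      (∀ t < 0, TendstoLocallyUniformly (fun n => nsRescale (mu n) W t) (W t) Filter.atTop)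

/-- **stub U2d — LANDED (v1.2)**: p710334 `PoloidalWindowDoorPoloidalWindowRigidityEternalCoreScalingRecurrentCore.scalingRecurrentCore` (ns-poloidal-K2-p2 g14), statement VERBATIM; wired BY NAME. -/
theorem stub_scalingRecurrentCore : ScalingRecurrentCore :=
  Summit.NavierStokesRegularity.NavierStokesRegularity.Theorems.PoloidalWindowDoorPoloidalWindowRigidityEternalCoreScalingRecurrentCore.scalingRecurrentCore

/-- **Column-wide export — EVERY PINNED PROFILE HAS A NON-ZERO, POLOIDAL, SCALING-RECURRENT BLOW-DOWN (from U2b + U2d; no sorry of its own).**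
Every research cell of the THICK column (and S0, and the (TH) column) is about pinned profiles and may import this far-past object as DATA. -/
theorem pinned_scalingRecurrentCore (hG : ParaboloidGap) (hS : ScalingRecurrentCore) {C : ℝ}
    {U : ℝ → EuclideanSpace ℝ (Fin 3) → EuclideanSpace ℝ (Fin 3)} (hP : Pinned C U) :
    ∃ (ε₀ R₀ : ℝ) (lam : ℕ → ℝ) (W : ℝ → EuclideanSpace ℝ (Fin 3) → EuclideanSpace ℝ (Fin 3)) (mu : ℕ → ℝ),
      0 < ε₀ ∧ 0 < R₀ ∧ EternalCore ε₀ R₀ (-1) U ∧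
      (∀ n : ℕ, (n : ℝ) + 1 ≤ lam n) ∧ IsTypeIAncientMild C W ∧
      (∀ t < 0, TendstoLocallyUniformly (fun n => nsRescale (lam n) U t) (W t) Filter.atTop) ∧
      (∀ s < 0, ∀ y, ⟪Literature.Analysis.FluidPDE.curl (W s) y, EuclideanSpace.single 2 1⟫_ℝ = 0) ∧
      (∀ t < 0, ∀ x, Real.sqrt (-t) * |W t x 2| ≤ |U (-1) 0 2|) ∧
      EternalCore ε₀ R₀ 0 W ∧
      (∀ n : ℕ, (n : ℝ) + 1 ≤ mu n) ∧
      (∀ t < 0, TendstoLocallyUniformly (fun n => nsRescale (mu n) W t) (W t) Filter.atTop) := by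
  obtain ⟨ε₀, hε₀, R₀, hR₀, hcore⟩ := eternalCore_of_pinned hG hP
  obtain ⟨lam, W, mu, h1, h2, h3, h4, h5, h6, h7, h8⟩ :=
    hS C (|U (-1) 0 2|) ε₀ R₀ U (class_of_pinned hP) hP.2.2.2.2.1 hP.2.2.2.2.2.2.1 hε₀ hcore
  exact ⟨ε₀, R₀, lam, W, mu, hε₀, hR₀, hcore, h1, h2, h3, h4, h5, h6, h7, h8⟩

/-! ## §6 LINE 22's research cell DEFECTIVE-RETURN-LEAF (VERBATIM) and its refinement by the far-past data -/


/-- **UniformReturn** — VERBATIM uniform_return v1.0 (LINE 22): translation symmetry in the limit, global scale-covariant metric. -/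
def UniformReturn (U : ℝ → EuclideanSpace ℝ (Fin 3) → EuclideanSpace ℝ (Fin 3)) : Prop :=
  ∀ ε : ℝ, 0 < ε → ∀ R : ℝ, ∃ τ : EuclideanSpace ℝ (Fin 3), R ≤ ‖τ‖ ∧
    ∀ t : ℝ, t < 0 → ∀ x, Real.sqrt (-t) * ‖U t (x + τ) - U t x‖ ≤ ε


/-- **CELL DEFECTIVE-RETURN-LEAF `CellDefectiveReturnLeaf`** — VERBATIM uniform_return v1.0 (LINE 22's research residue; the target this line concludes):
hot_hull v1.6's RECURRENT-LEAF binders + `¬ UniformReturn U`. -/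
def CellDefectiveReturnLeaf : Prop :=
  ∀ (C : ℝ) (U : ℝ → EuclideanSpace ℝ (Fin 3) → EuclideanSpace ℝ (Fin 3)) (W : Set (ℝ × EuclideanSpace ℝ (Fin 3))),
    Pinned C U → ThickWindow U W → Peakless U →
    (∀ s < 0, ∀ y, ⟪fderiv ℝ (U s) y (Literature.Analysis.FluidPDE.curl (U s) y), EuclideanSpace.single 2 1⟫_ℝ = 0) →
    IsClosed (hotSet U) → (∀ y ∈ hotSet U, fderiv ℝ (fun x => U (-1) x 2) y = 0) →
    (∀ K O : Set (EuclideanSpace ℝ (Fin 3)), IsCompact K → K.Nonempty → K ⊆ hotSet U → IsOpen O → K ⊆ O →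
      O ∩ hotSet U ⊆ K → False) →
    (∀ y ∈ hotSet U, ∀ r : ℝ, 0 < r →
      ∃ y' : EuclideanSpace ℝ (Fin 3), y' 2 = 0 ∧ dist y' y < r ∧ U (-1) y' 2 ≠ U (-1) 0 2) →
    (∀ y ∈ hotSet U, deriv (fun s => U s y 2) (-1) = U (-1) 0 2 / 2) →
    (∀ y ∈ hotSet U, U (-1) 0 2 * lapH U y ≤ 0) →
    (∀ c : ℝ → EuclideanSpace ℝ (Fin 3), Continuous c → (∀ θ : ℝ, c (θ + 1) = c θ) → Set.InjOn c (Set.Ico 0 1) →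
      (∀ θ : ℝ, c θ ∈ hotSet U) → False) →
    (∀ γ : ℝ → EuclideanSpace ℝ (Fin 3), (∀ τ : ℝ, HasDerivAt γ (Literature.Analysis.FluidPDE.curl (U (-1)) (γ τ)) τ) →
      ∀ q ∈ hotSet U, (MapClusterPt q Filter.atTop γ ∨ MapClusterPt q Filter.atBot γ) → ∀ τ : ℝ, γ τ ∈ hotSet U) →
    ∀ (γU : ℝ → EuclideanSpace ℝ (Fin 3)) (δ : ℝ), γU 0 = 0 →
      (∀ σ : ℝ, HasDerivAt γU (Literature.Analysis.FluidPDE.curl (U (-1)) (γU σ)) σ) → (∀ σ : ℝ, γU σ ∈ hotSet U) →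
      0 < δ → (∀ σ : ℝ, δ ≤ ‖Literature.Analysis.FluidPDE.curl (U (-1)) (γU σ)‖) →
      (∃ σs : ℕ → ℝ, Filter.Tendsto σs Filter.atTop Filter.atTop ∧
        (∀ t < 0, TendstoLocallyUniformly (fun k x => U t (x + γU (σs k))) (U t) Filter.atTop) ∧
        TendstoLocallyUniformly (fun k x => Literature.Analysis.FluidPDE.curl (U (-1)) (x + γU (σs k)))
          (Literature.Analysis.FluidPDE.curl (U (-1))) Filter.atTop ∧
        (∀ σ : ℝ, Filter.Tendsto (fun k => γU (σs k + σ) - γU (σs k)) Filter.atTop (nhds (γU σ)))) →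
      (∃ σs : ℕ → ℝ, Filter.Tendsto σs Filter.atTop Filter.atBot ∧
        (∀ t < 0, TendstoLocallyUniformly (fun k x => U t (x + γU (σs k))) (U t) Filter.atTop) ∧
        TendstoLocallyUniformly (fun k x => Literature.Analysis.FluidPDE.curl (U (-1)) (x + γU (σs k)))
          (Literature.Analysis.FluidPDE.curl (U (-1))) Filter.atTop ∧
        (∀ σ : ℝ, Filter.Tendsto (fun k => γU (σs k + σ) - γU (σs k)) Filter.atTop (nhds (γU σ)))) →
      (∀ ε : ℝ, 0 < ε → ∀ R : ℝ, 0 < R → ∃ L : ℝ, 0 < L ∧ ∀ a : ℝ, ∃ σ ∈ Set.Icc a (a + L),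
        ∀ t ∈ Set.Icc (-R) (-R⁻¹), ∀ x ∈ Metric.closedBall (0 : EuclideanSpace ℝ (Fin 3)) R,
          dist (U t (x + γU σ)) (U t x) ≤ ε) →
    ¬ UniformReturn U → False


/-- **CELL DEFECTIVE-RETURN-LEAF-CORE `CellDefectiveReturnLeafCore` (OPEN, research) — DEFECTIVE-RETURN-LEAF plus the FAR-PAST DATA of the pinned
profile `U`.**  Every binder of `CellDefectiveReturnLeaf` VERBATIM, then: an eternal core `(ε₀, R₀)` of `U` before time `−1` (PROVED for every pinned
profile, `eternalCore_of_pinned`); a blow-down limit `V = lim nsRescale (λₙ) U` at the pin (`λₙ ≥ n+1`, slice-wise locally uniformly) of the same Type-I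
class, e₂-POLOIDAL, with the extremal bound `√(−t)|V₂| ≤ |N|`, the eternal core in EVERY window (`V ≢ 0`: `0 ∉ α(U)`), and SCALING-RECURRENT along
`μₙ ≥ n+1` (U2d).  So the almost-periodic defective vortex leaf at time `−1` now comes with its ancestry: the profile descends from a non-zero poloidal
Type-I ancient flow `V` that returns to itself under zoom-out — the far-past alternative of the escaping return defects lives inside the windows
`[4λₙ²t₀, λₙ²t₀]` where `U ≈ nsRescale (λₙ)⁻¹ V`.  Exactly scale-symmetric corners: `V` (or `U`) backward self-similar — dead BY NAME (corner S,
Tsai); `U` globally small in the past — dead BY NAME (corner GS); `V` DISCRETELY self-similar (`IsDiscretelySelfSimilar μ V`) — the KNSS-(L) wall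
(pub-ns-dss census), OPEN and inherited honestly: this cell does not claim to breach it.  Killing quantity missing (honest): an interaction between
the time-`−1` hot geometry (pins, hot leaf, recurrence under sliding) and the zoom-out recurrence of the ancestry — two commuting non-compact group
directions (translations along the leaf, scalings at the pin) each recurrent, neither exact. -/
def CellDefectiveReturnLeafCore : Prop :=
  ∀ (C : ℝ) (U : ℝ → EuclideanSpace ℝ (Fin 3) → EuclideanSpace ℝ (Fin 3)) (W : Set (ℝ × EuclideanSpace ℝ (Fin 3))),
    Pinned C U → ThickWindow U W → Peakless U →
    (∀ s < 0, ∀ y, ⟪fderiv ℝ (U s) y (Literature.Analysis.FluidPDE.curl (U s) y), EuclideanSpace.single 2 1⟫_ℝ = 0) →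
    IsClosed (hotSet U) → (∀ y ∈ hotSet U, fderiv ℝ (fun x => U (-1) x 2) y = 0) →
    (∀ K O : Set (EuclideanSpace ℝ (Fin 3)), IsCompact K → K.Nonempty → K ⊆ hotSet U → IsOpen O → K ⊆ O →
      O ∩ hotSet U ⊆ K → False) →
    (∀ y ∈ hotSet U, ∀ r : ℝ, 0 < r →
      ∃ y' : EuclideanSpace ℝ (Fin 3), y' 2 = 0 ∧ dist y' y < r ∧ U (-1) y' 2 ≠ U (-1) 0 2) →
    (∀ y ∈ hotSet U, deriv (fun s => U s y 2) (-1) = U (-1) 0 2 / 2) →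
    (∀ y ∈ hotSet U, U (-1) 0 2 * lapH U y ≤ 0) →
    (∀ c : ℝ → EuclideanSpace ℝ (Fin 3), Continuous c → (∀ θ : ℝ, c (θ + 1) = c θ) → Set.InjOn c (Set.Ico 0 1) →
      (∀ θ : ℝ, c θ ∈ hotSet U) → False) →
    (∀ γ : ℝ → EuclideanSpace ℝ (Fin 3), (∀ τ : ℝ, HasDerivAt γ (Literature.Analysis.FluidPDE.curl (U (-1)) (γ τ)) τ) →
      ∀ q ∈ hotSet U, (MapClusterPt q Filter.atTop γ ∨ MapClusterPt q Filter.atBot γ) → ∀ τ : ℝ, γ τ ∈ hotSet U) →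
    ∀ (γU : ℝ → EuclideanSpace ℝ (Fin 3)) (δ : ℝ), γU 0 = 0 →
      (∀ σ : ℝ, HasDerivAt γU (Literature.Analysis.FluidPDE.curl (U (-1)) (γU σ)) σ) → (∀ σ : ℝ, γU σ ∈ hotSet U) →
      0 < δ → (∀ σ : ℝ, δ ≤ ‖Literature.Analysis.FluidPDE.curl (U (-1)) (γU σ)‖) →
      (∃ σs : ℕ → ℝ, Filter.Tendsto σs Filter.atTop Filter.atTop ∧
        (∀ t < 0, TendstoLocallyUniformly (fun k x => U t (x + γU (σs k))) (U t) Filter.atTop) ∧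
        TendstoLocallyUniformly (fun k x => Literature.Analysis.FluidPDE.curl (U (-1)) (x + γU (σs k)))
          (Literature.Analysis.FluidPDE.curl (U (-1))) Filter.atTop ∧
        (∀ σ : ℝ, Filter.Tendsto (fun k => γU (σs k + σ) - γU (σs k)) Filter.atTop (nhds (γU σ)))) →
      (∃ σs : ℕ → ℝ, Filter.Tendsto σs Filter.atTop Filter.atBot ∧
        (∀ t < 0, TendstoLocallyUniformly (fun k x => U t (x + γU (σs k))) (U t) Filter.atTop) ∧
        TendstoLocallyUniformly (fun k x => Literature.Analysis.FluidPDE.curl (U (-1)) (x + γU (σs k)))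
          (Literature.Analysis.FluidPDE.curl (U (-1))) Filter.atTop ∧
        (∀ σ : ℝ, Filter.Tendsto (fun k => γU (σs k + σ) - γU (σs k)) Filter.atTop (nhds (γU σ)))) →
      (∀ ε : ℝ, 0 < ε → ∀ R : ℝ, 0 < R → ∃ L : ℝ, 0 < L ∧ ∀ a : ℝ, ∃ σ ∈ Set.Icc a (a + L),
        ∀ t ∈ Set.Icc (-R) (-R⁻¹), ∀ x ∈ Metric.closedBall (0 : EuclideanSpace ℝ (Fin 3)) R,
          dist (U t (x + γU σ)) (U t x) ≤ ε) →
 ¬ UniformReturn U →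
    ∀ (ε₀ R₀ : ℝ) (lam : ℕ → ℝ) (V : ℝ → EuclideanSpace ℝ (Fin 3) → EuclideanSpace ℝ (Fin 3)) (mu : ℕ → ℝ),
      0 < ε₀ → 0 < R₀ → EternalCore ε₀ R₀ (-1) U →
      (∀ n : ℕ, (n : ℝ) + 1 ≤ lam n) → IsTypeIAncientMild C V →
      (∀ t < 0, TendstoLocallyUniformly (fun n => nsRescale (lam n) U t) (V t) Filter.atTop) →
      (∀ s < 0, ∀ y, ⟪Literature.Analysis.FluidPDE.curl (V s) y, EuclideanSpace.single 2 1⟫_ℝ = 0) →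
      (∀ t < 0, ∀ x, Real.sqrt (-t) * |V t x 2| ≤ |U (-1) 0 2|) →
      EternalCore ε₀ R₀ 0 V →
      (∀ n : ℕ, (n : ℝ) + 1 ≤ mu n) →
      (∀ t < 0, TendstoLocallyUniformly (fun n => nsRescale (mu n) V t) (V t) Filter.atTop) →
    False


/-- **stub DEFECTIVE-RETURN-LEAF-CORE** (OPEN, research). -/
theorem stub_cellDefectiveReturnLeafCore : CellDefectiveReturnLeafCore := by
  sorry

/-! ## §7 Kernel (checked, no sorry): DEFECTIVE-RETURN-LEAF ⇐ U2b ∧ U2d ∧ DEFECTIVE-RETURN-LEAF-CORE -/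

/-- **Kernel of LINE 23.**  LINE 22's research cell `CellDefectiveReturnLeaf` (VERBATIM) follows from the analytic hand stub U2b (`ParaboloidGap`),
the dynamical hand stub U2d (`ScalingRecurrentCore`) and the ONE research residue `CellDefectiveReturnLeafCore`: the far-past data are PRODUCED for
the cell's own pinned profile by `pinned_scalingRecurrentCore` and handed over. -/
theorem cellDefectiveReturnLeaf_of_core (hG : ParaboloidGap) (hS : ScalingRecurrentCore) (hK : CellDefectiveReturnLeafCore) :
    CellDefectiveReturnLeaf := by
  intro C U W h1 h2 h3 h4 h5 h6 h7 h8 h9 h10 h11 h12 γU δ g1 g2 g3 g4 g5 g6 g7 g8 hu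
  obtain ⟨ε₀, R₀, lam, V, mu, hε₀, hR₀, hcore, k1, k2, k3, k4, k5, k6, k7, k8⟩ := pinned_scalingRecurrentCore hG hS h1
  exact hK C U W h1 h2 h3 h4 h5 h6 h7 h8 h9 h10 h11 h12 γU δ g1 g2 g3 g4 g5 g6 g7 g8 hu ε₀ R₀ lam V mu hε₀ hR₀ hcore
    k1 k2 k3 k4 k5 k6 k7 k8

/-- **The line's deliverable in one statement**: with the two hand stubs discharged, DEFECTIVE-RETURN-LEAF reduces to DEFECTIVE-RETURN-LEAF-CORE. -/
theorem cellDefectiveReturnLeaf_of_stubs (hK : CellDefectiveReturnLeafCore) : CellDefectiveReturnLeaf :=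
  cellDefectiveReturnLeaf_of_core stub_paraboloidGap stub_scalingRecurrentCore hK

end Summit.NavierStokesRegularity.NavierStokesRegularity.Cruxes.PoloidalWindowRigidity.EternalCore
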